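import Literature.Analysis.FluidPDE.ExtremeGrowthVorticityControlProofs
import HarnessLib

/-!
# The enstrophy–strain identity on `T³`: `dℰ/dt = -ν‖Δu‖₂² - (4/3)∫tr S³ = -ν‖Δu‖₂² - 4∫det S` — PROVED

Analysis/FluidPDE proof file (theorems only: no definitions, no named facts), sequel of
`ExtremeGrowthVorticityControlProofs.lean` (Betchov's identity `∫ tr (∇u)³ = 0` on the torus).
For a classical solution of the UNFORCED Navier–Stokes (`ν ≥ 0`, so also Euler) equations on the
unit 3-torus, the enstrophy `ℰ = ½‖∇u‖₂²` (`torusEnstrophy`) evolves by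

`dℰ/dt = -ν‖Δu‖₂² - (4/3) ∫ tr (S³) = -ν‖Δu‖₂² - 4 ∫ det S`,  `S = ½(∇u + ∇uᵀ)`,

the periodic, classical-solution form of the Neustupa–Penel / Miller identity (Miller, Anal. PDE
16 (2023), Prop. 1.9, stated on `ℝ³` for `Ḣ¹`-mild solutions: "`∂ₜ‖S(t)‖²_{L²} =
-2‖S‖²_{Ḣ¹} - (4/3)∫tr(S³) = -2‖S‖²_{Ḣ¹} - 4∫det(S)`. This identity was first proven by
Neustupa and Penel"; note `‖S‖₂² = ½‖∇u‖₂² = ℰ` for divergence-free fields) and of Betchov's 1956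
relation between `⟨ω·Sω⟩` and `⟨tr S³⟩` for homogeneous incompressible fields. Equivalently, the
vortex-stretching term is `∫ ω·Sω = -∫ tr (GGᵀG) = -(4/3)∫ tr S³ = -4∫ det S` (`Gᵢⱼ = ∂ⱼuᵢ`).

Proof: pointwise polynomial identity `3 tr (GGᵀG) = 4 tr S³ - tr G³` (any `3 × 3` array; `ring`),
Betchov `∫ tr G³ = 0` (`integral_sum_partialDeriv_cube_eq_zero`), and, for the determinant form,
`tr S³ = 3 det S` for symmetric trace-free `3 × 3` `S` (Cayley–Hamilton, `Matrix.det_fin_three` +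
`ring`), with `tr S = div u = 0`. The general index type `d`, `Fintype.card d = 3`, is transported
to `Fin 3` pointwise; the determinant is Mathlib's `Matrix.det` of the `d × d` strain matrix
(`Matrix.det_reindex_self`).

* (private) `DoeringGibbon1995.three_mul_stretchCubic_eq` — `3 tr GGᵀG = 4 tr S³ - tr G³` on `Fin 3`;
* `DoeringGibbon1995.trace_strain_cube_eq_three_mul_det` — `tr S³ = 3 det S` (symmetric, trace-free);
* `integral_stretching_eq_four_thirds_integral_trace_strain_cube` — `∫ tr GGᵀG = (4/3)∫ tr S³`
  for smooth divergence-free `u : T^d → ℝ^d`, `card d = 3`;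
* `integral_stretching_eq_four_mul_integral_det_strain` — `∫ tr GGᵀG = 4 ∫ det S`;
* `Torus.IsClassicalNSSolutionOn.hasDerivWithinAt_torusEnstrophy_strain` /
  `…_det` — the enstrophy balance in strain form along classical unforced solutions.

These serve the functional-mining cell (pub-nsfunc): the `det S` / `tr S³` / `λ₂⁺` family of
candidate functionals (Miller's criterion `Miller2019.middleEigenvalueCriterion`) is tied to the
enstrophy budget by exactly this identity (TAO-BARRIER.md §3, §4(d)).

## Mathlib / tree search

Tree: `integral_sum_partialDeriv_cube_eq_zero`, `Torus.integral_inner_laplacian_convect_self_eq_neg`,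
`Torus.IsClassicalNSSolutionOn.hasDerivWithinAt_half_gradNormSq`, torus calculus as listed in the
predecessor file; `lean search 'det.*strain|trace_strain|tr S\\^3'`: nothing. Mathlib:
`Matrix.det_fin_three`, `Matrix.det_reindex_self`.

## References

* E. Miller, Anal. PDE 16 (2023) 997–1032 = arXiv:1910.05415, Prop. 1.9 (held text p. 5).
  [Miller2023StrainModel]
* J. Neustupa, P. Penel, in *Mathematical Fluid Mechanics*, Birkhäuser 2001, 237–265. [NeustupaPenel2001]
* R. Betchov, J. Fluid Mech. 1 (1956) 497–504. [Betchov1956]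
-/

noncomputable section

open Set MeasureTheory Finset
open scoped InnerProductSpace RealInnerProductSpace

namespace Literature.Analysis.FluidPDE

open Literature.Analysis.FunctionSpaces

namespace DoeringGibbon1995

/-- `3 tr (GGᵀG) = 4 tr S³ - tr G³` for a `3 × 3` array, `S = ½(G + Gᵀ)` (polynomial identity;
the traces of the six mixed words in the expansion of `tr (G + Gᵀ)³` all equal `tr GGᵀG`).
[folklore] -/
private theorem three_mul_stretchCubic_eq (G : Fin 3 → Fin 3 → ℝ) :
    3 * (∑ i, ∑ j, ∑ m, G i m * G j m * G j i) =
      4 * (∑ i, ∑ j, ∑ k, ((G i j + G j i) / 2) * ((G j k + G k j) / 2) * ((G k i + G i k) / 2)) -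
        ∑ i, ∑ j, ∑ k, G i j * G j k * G k i := by
  simp only [Fin.sum_univ_three]
  ring

/-- `tr S³ = 3 det S` for a symmetric trace-free `3 × 3` array (Cayley–Hamilton; Miller 2023,
Prop. 1.9: `(4/3)∫tr(S³) = 4∫det(S)`). [cite: Miller2023StrainModel, Prop. 1.9] -/
theorem trace_strain_cube_eq_three_mul_det (S : Fin 3 → Fin 3 → ℝ) (hsym : ∀ i j, S i j = S j i)
    (htr : ∑ i, S i i = 0) :
    ∑ i, ∑ j, ∑ k, S i j * S j k * S k i = 3 * Matrix.det (Matrix.of fun i j => S i j) := by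
  rw [Matrix.det_fin_three]
  simp only [Fin.sum_univ_three, Matrix.of_apply] at htr ⊢
  have h10 := hsym 1 0
  have h20 := hsym 2 0
  have h21 := hsym 2 1
  have h00 : S 0 0 = -(S 1 1 + S 2 2) := by linarith
  rw [h10, h20, h21, h00]
  ring

end DoeringGibbon1995

variable {d : Type*} [Fintype d] [DecidableEq d]

/-- **`∫ tr (GGᵀG) = (4/3) ∫ tr S³`** for a smooth divergence-free field on `T^d`, `card d = 3`,
`Gᵢⱼ = (∂ⱼu)ᵢ`, `Sᵢⱼ = ½((∂ⱼu)ᵢ + (∂ᵢu)ⱼ)`: the stretching cubic `∑ₘᵢ (∂ₘu)ᵢ⟪∂ₘu, ∂ᵢu⟫` of the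
tree's orthogonality form equals `4/3` times the integral of the trace of the strain cube
(pointwise `3 tr GGᵀG = 4 tr S³ - tr G³` and Betchov `∫ tr G³ = 0`; Miller 2023, Prop. 1.9, on
`ℝ³`). [cite: Miller2023StrainModel, Prop. 1.9] -/
theorem integral_stretching_eq_four_thirds_integral_trace_strain_cube (hd : Fintype.card d = 3)
    {u : UnitAddTorus d → EuclideanSpace ℝ d} (hu : Torus.IsSmooth u) (hdiv : Torus.IsDivFree u) :
    ∫ x, ∑ m, ∑ i, Torus.partialDeriv m u x i *
        ⟪Torus.partialDeriv m u x, Torus.partialDeriv i u x⟫_ℝ =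
      (4 / 3) * ∫ x, ∑ i, ∑ j, ∑ k,
        ((Torus.partialDeriv j u x i + Torus.partialDeriv i u x j) / 2) *
        ((Torus.partialDeriv k u x j + Torus.partialDeriv j u x k) / 2) *
        ((Torus.partialDeriv i u x k + Torus.partialDeriv k u x i) / 2) := by
  have hD : ∀ m, Torus.IsSmooth (Torus.partialDeriv m u) := fun m => hu.partialDeriv m
  have hDc : ∀ m j, Torus.IsSmooth (fun y => Torus.partialDeriv m u y j) :=
    fun m j => (hD m).apply j
  -- pointwise: `3 C = 4 T - B`
  have hpt : ∀ x, 3 * (∑ m, ∑ i, Torus.partialDeriv m u x i *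
      ⟪Torus.partialDeriv m u x, Torus.partialDeriv i u x⟫_ℝ) =
      4 * (∑ i, ∑ j, ∑ k,
        ((Torus.partialDeriv j u x i + Torus.partialDeriv i u x j) / 2) *
        ((Torus.partialDeriv k u x j + Torus.partialDeriv j u x k) / 2) *
        ((Torus.partialDeriv i u x k + Torus.partialDeriv k u x i) / 2)) -
      ∑ i, ∑ j, ∑ k, Torus.partialDeriv j u x i * Torus.partialDeriv k u x j *
        Torus.partialDeriv i u x k := by
    intro x
    set e : d ≃ Fin 3 := Fintype.equivFinOfCardEq hd with he
    set R : d → EuclideanSpace ℝ d := fun m => Torus.partialDeriv m u x with hR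
    set G : Fin 3 → Fin 3 → ℝ := fun a b => R (e.symm b) (e.symm a) with hG
    have hre : ∀ F : d → ℝ, ∑ i, F i = ∑ a : Fin 3, F (e.symm a) := fun F =>
      Fintype.sum_equiv e _ _ fun i => by simp
    have hC : ∑ m, ∑ i, R m i * ⟪R m, R i⟫_ℝ = ∑ a, ∑ b, ∑ c, G a c * G b c * G b a := by
      have h1 : ∑ m, ∑ i, R m i * ⟪R m, R i⟫_ℝ = ∑ i, ∑ j, ∑ m, R m i * R m j * R i j := by
        have hinner : ∀ m i, R m i * ⟪R m, R i⟫_ℝ = ∑ j, R m i * R m j * R i j := by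
          intro m i
          rw [show ⟪R m, R i⟫_ℝ = ∑ j, R m j * R i j from by simp [PiLp.inner_apply, mul_comm],
            Finset.mul_sum]
          exact Finset.sum_congr rfl fun j _ => by ring
        simp_rw [hinner]
        rw [Finset.sum_comm]
        exact Finset.sum_congr rfl fun i _ => Finset.sum_comm
      rw [h1]
      simp only [hG]
      simp_rw [hre]
    have hB : ∑ i, ∑ j, ∑ k, R j i * R k j * R i k = ∑ a, ∑ b, ∑ c, G a b * G b c * G c a := by
      simp only [hG]
      simp_rw [hre]
    have hT : (∑ i, ∑ j, ∑ k, ((R j i + R i j) / 2) * ((R k j + R j k) / 2) * ((R i k + R k i) / 2)) =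
        ∑ a, ∑ b, ∑ c, ((G a b + G b a) / 2) * ((G b c + G c b) / 2) * ((G c a + G a c) / 2) := by
      simp only [hG]
      simp_rw [hre]
    rw [hC, hB, hT]
    exact DoeringGibbon1995.three_mul_stretchCubic_eq G
  -- integrability
  have hCs : Torus.IsSmooth (fun x => ∑ m, ∑ i, Torus.partialDeriv m u x i *
      ⟪Torus.partialDeriv m u x, Torus.partialDeriv i u x⟫_ℝ) := by
    have h : ∀ m i, Torus.IsSmooth (fun x => Torus.partialDeriv m u x i *
        ⟪Torus.partialDeriv m u x, Torus.partialDeriv i u x⟫_ℝ) :=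
      fun m i => (hDc m i).mul ((hD m).inner (hD i))
    unfold Torus.IsSmooth at h ⊢
    exact ContDiff.sum fun m _ => ContDiff.sum fun i _ => h m i
  have hBs : Torus.IsSmooth (fun x => ∑ i, ∑ j, ∑ k, Torus.partialDeriv j u x i *
      Torus.partialDeriv k u x j * Torus.partialDeriv i u x k) := by
    have h : ∀ i j k, Torus.IsSmooth (fun x => Torus.partialDeriv j u x i *
        Torus.partialDeriv k u x j * Torus.partialDeriv i u x k) :=
      fun i j k => ((hDc j i).mul (hDc k j)).mul (hDc i k)
    unfold Torus.IsSmooth at h ⊢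
    exact ContDiff.sum fun i _ => ContDiff.sum fun j _ => ContDiff.sum fun k _ => h i j k
  have hSc : ∀ i j, Torus.IsSmooth (fun x => (Torus.partialDeriv j u x i +
      Torus.partialDeriv i u x j) / 2) := by
    intro i j
    have h : Torus.IsSmooth (fun x => (Torus.partialDeriv j u x i + Torus.partialDeriv i u x j) / 2) :=
      ((hDc j i).add (hDc i j)).div_const 2
    exact h
  have hTs : Torus.IsSmooth (fun x => ∑ i, ∑ j, ∑ k,
        ((Torus.partialDeriv j u x i + Torus.partialDeriv i u x j) / 2) *
        ((Torus.partialDeriv k u x j + Torus.partialDeriv j u x k) / 2) *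
        ((Torus.partialDeriv i u x k + Torus.partialDeriv k u x i) / 2)) := by
    have h : ∀ i j k, Torus.IsSmooth (fun x =>
        ((Torus.partialDeriv j u x i + Torus.partialDeriv i u x j) / 2) *
        ((Torus.partialDeriv k u x j + Torus.partialDeriv j u x k) / 2) *
        ((Torus.partialDeriv i u x k + Torus.partialDeriv k u x i) / 2)) :=
      fun i j k => ((hSc i j).mul (hSc j k)).mul (hSc k i)
    unfold Torus.IsSmooth at h ⊢
    exact ContDiff.sum fun i _ => ContDiff.sum fun j _ => ContDiff.sum fun k _ => h i j k
  have hBet : ∫ x, ∑ i, ∑ j, ∑ k, Torus.partialDeriv j u x i * Torus.partialDeriv k u x j *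
      Torus.partialDeriv i u x k = 0 := integral_sum_partialDeriv_cube_eq_zero hu hdiv
  -- integrate `C = (4 T - B)/3`
  have hC3 : ∀ x, (∑ m, ∑ i, Torus.partialDeriv m u x i *
      ⟪Torus.partialDeriv m u x, Torus.partialDeriv i u x⟫_ℝ) =
      (4 / 3) * (∑ i, ∑ j, ∑ k,
        ((Torus.partialDeriv j u x i + Torus.partialDeriv i u x j) / 2) *
        ((Torus.partialDeriv k u x j + Torus.partialDeriv j u x k) / 2) *
        ((Torus.partialDeriv i u x k + Torus.partialDeriv k u x i) / 2)) -
      (1 / 3) * ∑ i, ∑ j, ∑ k, Torus.partialDeriv j u x i * Torus.partialDeriv k u x j *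
        Torus.partialDeriv i u x k := by
    intro x
    have h := hpt x
    linarith
  simp_rw [hC3]
  rw [integral_sub (hTs.integrable.const_mul _) (hBs.integrable.const_mul _), integral_const_mul,
    integral_const_mul, hBet, mul_zero, sub_zero]

/-- **`∫ tr (GGᵀG) = 4 ∫ det S`** on `T^d`, `card d = 3`: the determinant form of the preceding
identity (`tr S³ = 3 det S` since `tr S = div u = 0`; Miller 2023, Prop. 1.9, on `ℝ³`:
`-(4/3)∫tr(S³) = -4∫det(S)`), with `S(x)` the `d × d` strain matrix
`Matrix.of fun i j => ½((∂ⱼu)ᵢ + (∂ᵢu)ⱼ)`. [cite: Miller2023StrainModel, Prop. 1.9] -/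
theorem integral_stretching_eq_four_mul_integral_det_strain (hd : Fintype.card d = 3)
    {u : UnitAddTorus d → EuclideanSpace ℝ d} (hu : Torus.IsSmooth u) (hdiv : Torus.IsDivFree u) :
    ∫ x, ∑ m, ∑ i, Torus.partialDeriv m u x i *
        ⟪Torus.partialDeriv m u x, Torus.partialDeriv i u x⟫_ℝ =
      4 * ∫ x, Matrix.det (Matrix.of fun i j =>
        (Torus.partialDeriv j u x i + Torus.partialDeriv i u x j) / 2) := by
  rw [integral_stretching_eq_four_thirds_integral_trace_strain_cube hd hu hdiv]
  have hpt : ∀ x, (∑ i, ∑ j, ∑ k,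
        ((Torus.partialDeriv j u x i + Torus.partialDeriv i u x j) / 2) *
        ((Torus.partialDeriv k u x j + Torus.partialDeriv j u x k) / 2) *
        ((Torus.partialDeriv i u x k + Torus.partialDeriv k u x i) / 2)) =
      3 * Matrix.det (Matrix.of fun i j =>
        (Torus.partialDeriv j u x i + Torus.partialDeriv i u x j) / 2) := by
    intro x
    set e : d ≃ Fin 3 := Fintype.equivFinOfCardEq hd with he
    set R : d → EuclideanSpace ℝ d := fun m => Torus.partialDeriv m u x with hR
    set Sd : Matrix d d ℝ := Matrix.of fun i j => (R j i + R i j) / 2 with hSd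
    set S3 : Fin 3 → Fin 3 → ℝ := fun a b => Sd (e.symm a) (e.symm b) with hS3
    have hre : ∀ F : d → ℝ, ∑ i, F i = ∑ a : Fin 3, F (e.symm a) := fun F =>
      Fintype.sum_equiv e _ _ fun i => by simp
    have hdet : Matrix.det Sd = Matrix.det (Matrix.of fun a b => S3 a b) := by
      rw [← Matrix.det_reindex_self e Sd]
      rfl
    have hsym : ∀ a b, S3 a b = S3 b a := by
      intro a b; simp only [hS3, hSd, Matrix.of_apply]; ring
    have htr : ∑ a, S3 a a = 0 := by
      have h1 : ∑ a, S3 a a = ∑ m, R m m := by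
        simp only [hS3, hSd, Matrix.of_apply]
        rw [hre]
        exact Finset.sum_congr rfl fun a _ => by ring
      rw [h1, hR]
      have h2 := Torus.divergence_eq_sum_partialDeriv_apply (hu.isContDiff (by simp)) x
      rw [← h2]
      exact hdiv x
    have hT : (∑ i, ∑ j, ∑ k, ((R j i + R i j) / 2) * ((R k j + R j k) / 2) * ((R i k + R k i) / 2)) =
        ∑ a, ∑ b, ∑ c, S3 a b * S3 b c * S3 c a := by
      simp only [hS3, hSd, Matrix.of_apply]
      simp_rw [hre]
    rw [hT, DoeringGibbon1995.trace_strain_cube_eq_three_mul_det S3 hsym htr, ← hdet]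
  simp_rw [hpt]
  rw [integral_const_mul]
  ring

/-- **Enstrophy balance in strain form** (Neustupa–Penel; Miller 2023, Prop. 1.9, periodic classical
version): along a classical solution of the unforced Navier–Stokes equations (`ν` arbitrary, Euler
included) on `T^d × [a, b]`, `card d = 3`, `a < b`, at every `t ∈ [a, b]`,
`dℰ/dt = -ν‖Δu‖₂² - (4/3) ∫ tr S³` as a one-sided derivative within `[a, b]`
(`ℰ = torusEnstrophy = ½‖∇u‖₂²`). [cite: Miller2023StrainModel, Prop. 1.9] -/
theorem _root_.Literature.Analysis.FunctionSpaces.Torus.IsClassicalNSSolutionOn.hasDerivWithinAt_torusEnstrophy_strain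
    (hd : Fintype.card d = 3) {a b ν : ℝ} {u : ℝ → UnitAddTorus d → EuclideanSpace ℝ d}
    {p : ℝ → UnitAddTorus d → ℝ} (h : Torus.IsClassicalNSSolutionOn (Icc a b) ν 0 u p)
    (hab : a < b) {t : ℝ} (ht : t ∈ Icc a b) :
    HasDerivWithinAt (fun s => torusEnstrophy (u s))
      (-ν * (∫ x, ‖Torus.laplacian (u t) x‖ ^ 2) -
        (4 / 3) * ∫ x, ∑ i, ∑ j, ∑ k,
          ((Torus.partialDeriv j (u t) x i + Torus.partialDeriv i (u t) x j) / 2) *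
          ((Torus.partialDeriv k (u t) x j + Torus.partialDeriv j (u t) x k) / 2) *
          ((Torus.partialDeriv i (u t) x k + Torus.partialDeriv k (u t) x i) / 2)) (Icc a b) t := by
  have hut : Torus.IsSmooth (u t) := h.smooth_velocity.isSmooth_slice ht
  have hdivt : Torus.IsDivFree (u t) := h.divFree t ht
  have hbal := h.hasDerivWithinAt_half_gradNormSq hab ht
  have hconv : ∫ x, ⟪Torus.convect (u t) (u t) x - (0 : ℝ → UnitAddTorus d → EuclideanSpace ℝ d) t x,
        Torus.laplacian (u t) x⟫_ℝ =
      ∫ x, ⟪Torus.laplacian (u t) x, Torus.convect (u t) (u t) x⟫_ℝ := by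
    refine integral_congr_ae (Filter.Eventually.of_forall fun x => ?_)
    simp only [Pi.zero_apply, sub_zero]
    exact real_inner_comm _ _
  have horth := Torus.integral_inner_laplacian_convect_self_eq_neg hut hdivt
  have hid := integral_stretching_eq_four_thirds_integral_trace_strain_cube hd hut hdivt
  have hbal' : HasDerivWithinAt (fun s => torusEnstrophy (u s))
      (-ν * (∫ x, ‖Torus.laplacian (u t) x‖ ^ 2) +
        ∫ x, ⟪Torus.convect (u t) (u t) x - (0 : ℝ → UnitAddTorus d → EuclideanSpace ℝ d) t x,
          Torus.laplacian (u t) x⟫_ℝ) (Icc a b) t := hbal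
  refine hbal'.congr_deriv ?_
  rw [hconv, horth, hid]
  ring

/-- **Enstrophy balance, determinant form**: under the same hypotheses,
`dℰ/dt = -ν‖Δu‖₂² - 4 ∫ det S(x) dx`, `S(x) = Matrix.of fun i j => ½((∂ⱼu)ᵢ + (∂ᵢu)ⱼ)`
(Miller 2023, Prop. 1.9: `∂ₜ‖S‖²_{L²} = -2‖S‖²_{Ḣ¹} - 4∫det(S)`, here on `T³` for classical
solutions). [cite: Miller2023StrainModel, Prop. 1.9] -/
theorem _root_.Literature.Analysis.FunctionSpaces.Torus.IsClassicalNSSolutionOn.hasDerivWithinAt_torusEnstrophy_det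
    (hd : Fintype.card d = 3) {a b ν : ℝ} {u : ℝ → UnitAddTorus d → EuclideanSpace ℝ d}
    {p : ℝ → UnitAddTorus d → ℝ} (h : Torus.IsClassicalNSSolutionOn (Icc a b) ν 0 u p)
    (hab : a < b) {t : ℝ} (ht : t ∈ Icc a b) :
    HasDerivWithinAt (fun s => torusEnstrophy (u s))
      (-ν * (∫ x, ‖Torus.laplacian (u t) x‖ ^ 2) -
        4 * ∫ x, Matrix.det (Matrix.of fun i j =>
          (Torus.partialDeriv j (u t) x i + Torus.partialDeriv i (u t) x j) / 2)) (Icc a b) t := by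
  have hut : Torus.IsSmooth (u t) := h.smooth_velocity.isSmooth_slice ht
  have hdivt : Torus.IsDivFree (u t) := h.divFree t ht
  have h1 := h.hasDerivWithinAt_torusEnstrophy_strain hd hab ht
  refine h1.congr_deriv ?_
  have h2 := integral_stretching_eq_four_thirds_integral_trace_strain_cube hd hut hdivt
  have h3 := integral_stretching_eq_four_mul_integral_det_strain hd hut hdivt
  rw [← h2, h3]

end Literature.Analysis.FluidPDE
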